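import Literature.Geometry.Lorentzian.KerrDeSitterRealFrequencyModes
import HarnessLib

/-!
# Spin-`s` radial Teukolsky solutions on subextremal Kerr–de Sitter: the horizons as regular singular
# points, and unique continuation from a vanishing horizon amplitude

Theorems only (no named facts, no new definitions). This file extends to EVERY spin `s` the two
`s = 0` statements of `KerrDeSitterRealFrequencyModes.lean` (`exists_branchCoeffs`,
`masterRadial_zero_eq_zero_of_eventAmplitude_eq_zero` / `…_of_cosmoAmplitude_eq_zero`) that the printed
real-frequency arguments appeal to as "unique continuation for ODEs such as (3.9)"
([CasalsTeixeiradacosta2022], proof of Theorem 3.10, Step 1, arXiv v3 p. 17):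

* `horizonB_indicial`, `negSpinSub_horizonB_indicial` — at a simple zero `r_h` of `Δ_r` the two local
  exponents `B(r_h)` and `−s − B(r_h)` of the radial Teukolsky function (Hatsuda 2020 (2.18): "the local
  exponents … are `B(r_h)` and `−s − B(r_h)`") satisfy the spin-`s` indicial relation
  `z² + sz = −Ξ²K(r_h)²/Δ_r'(r_h)² + isΞK(r_h)/Δ_r'(r_h)`.
* `exists_branchCoeffs_spin` — with the exact factorisation `Δ_r = (r − p)σ_p(r)`, for such an
  exponent `z` the transformed coefficients `P = 2z + (s+1)Δ_r'/σ_p` and `Q` (the equation for the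
  cofactor `f` of `R = (r − p)^z f` is `(r − p)f'' + Pf' + Qf = 0`) extend continuously across `p`,
  with `Re P(p) = 2 Re z + s + 1` — the cancellation of the `1/(r − p)` singularity of `Q` IS the
  indicial relation (pure polynomial algebra, as in the `s = 0` file).
* `radial_eq_zero_of_eventAmplitude_eq_zero` — a classical solution of the spin-`s` radial Teukolsky
  equation on `(r₊, r_c)` which is INGOING at `𝓗⁺` (`R(r)(r − r₊)^{s + B(r₊)} = f(r)`, `f` smooth at
  `r₊`) with vanishing horizon amplitude `f(r₊) = 0` vanishes identically, provided `Im ω ≥ 0` and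
  `s < 1` (then `Re P(r₊) = 1 − s + 2Ξ(r₊²+a²)Im ω/Δ_r'(r₊) > 0`);
* `radial_eq_zero_of_cosmoAmplitude_eq_zero` — the same at the cosmological horizon for an OUTGOING
  solution (`R(r)(r_c − r)^{−B(r_c)} = g(r)`, `g(r_c) = 0`), provided `Im ω ≥ 0` and `−1 < s`
  (`Re P(r_c) = 1 + s − 2Ξ(r_c²+a²)Im ω/Δ_r'(r_c) > 0`, `Δ_r'(r_c) < 0`).

Mechanism (both): the abstract regular-singular uniqueness `eq_zero_near_of_cpowBranch_zero`
(`_left`) gives `R ≡ 0` near the horizon, and Grönwall uniqueness along the exterior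
(`masterRadial_eq_zero_of_eventuallyEq_zero`, through `isMasterRadialSolution_one_iff`) gives `R ≡ 0`
on `(r₊, r_c)`. These are the "branch solution with vanishing leading coefficient is trivial" inputs
of the real-axis energy identities for half-integer spin (`KerrDeSitterFermionicRealAxis.lean`).

References: [CasalsTeixeiradacosta2022] M. Casals, R. Teixeira da Costa, Commun. Math. Phys. 394
(2022) 797–832, Theorem 3.10 (proof, Step 1) and Definition 3.3; [Hatsuda2020] Y. Hatsuda, Class.
Quantum Grav. 38 (2020) 025015, (2.13), (2.18); [SuzukiTakasugiUmetsu1998] Prog. Theor. Phys. 100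
(1998) 491, (3.7).
-/

noncomputable section

open Complex Set Filter Topology

namespace Literature.Geometry.Lorentzian.KerrDeSitter

/-! ### The spin-`s` indicial relation at a horizon -/

/-- The horizon exponent `B(r_h) = iΞK(r_h)/Δ_r'(r_h)` satisfies the spin-`s` indicial relation
`z² + sz = −Ξ²K²/Δ_r'² + isΞK/Δ_r'` (the exponent of the OUTGOING branch at `r_c`, resp. of the
non-preferred branch at `r₊`). [cite: Hatsuda2020, (2.18)] -/
theorem horizonB_indicial (M a Λ s : ℝ) (ω : ℂ) (m : ℝ) (rh : ℝ) :
    horizonB M a Λ ω m rh ^ 2 + (s : ℂ) * horizonB M a Λ ω m rh =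
      -((xi a Λ : ℂ) ^ 2 * radialK a ω m rh ^ 2 / (deltaDeriv M a Λ rh : ℂ) ^ 2) +
        I * (s : ℂ) * (xi a Λ : ℂ) * radialK a ω m rh / (deltaDeriv M a Λ rh : ℂ) := by
  rw [horizonB_sq]
  simp only [horizonB]
  ring

/-- The second exponent `−s − B(r_h)` satisfies the same spin-`s` indicial relation (the exponent of
the INGOING branch at `r₊`: "`R ∼ (r − r₊)^{−s − B(r₊)}`"). [cite: Hatsuda2020, (2.18)] -/
theorem negSpinSub_horizonB_indicial (M a Λ s : ℝ) (ω : ℂ) (m : ℝ) (rh : ℝ) :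
    (-(s : ℂ) - horizonB M a Λ ω m rh) ^ 2 + (s : ℂ) * (-(s : ℂ) - horizonB M a Λ ω m rh) =
      -((xi a Λ : ℂ) ^ 2 * radialK a ω m rh ^ 2 / (deltaDeriv M a Λ rh : ℂ) ^ 2) +
        I * (s : ℂ) * (xi a Λ : ℂ) * radialK a ω m rh / (deltaDeriv M a Λ rh : ℂ) := by
  rw [← horizonB_indicial M a Λ s ω m rh]
  ring

/-! ### The transformed coefficients at a simple zero of `Δ_r`, spin `s` -/

/-- The spin-`s` radial Teukolsky coefficient splits as `(Ξ²K² − isΞKΔ_r')/Δ_r` plus a part regular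
at the horizons, `4isΞωr − (2Λ/3)(s+1)(2s+1)r² + 2s(1−α) − λ`. [cite: SuzukiTakasugiUmetsu1998, (3.7)] -/
theorem radialPotential_split (M a Λ s : ℝ) (ω : ℂ) (m : ℝ) (lam : ℂ) (r : ℝ) :
    radialPotential M a Λ s ω m lam r =
      ((xi a Λ : ℂ) ^ 2 * radialK a ω m r ^ 2 -
            I * (s : ℂ) * (xi a Λ : ℂ) * radialK a ω m r * (deltaDeriv M a Λ r : ℂ)) /
          (delta M a Λ r : ℂ) +
        (4 * I * (s : ℂ) * (xi a Λ : ℂ) * ω * (r : ℂ) -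
            ((2 * Λ / 3 * (s + 1) * (2 * s + 1) * r ^ 2 : ℝ) : ℂ) +
            ((2 * s * (1 - alpha a Λ) : ℝ) : ℂ) - lam) := by
  simp only [radialPotential]
  ring

/-- **The transformed coefficients at a simple zero `p` of `Δ_r`, spin `s`.** With the exact
factorisation `Δ_r(r) = (r − p)σ_p(r)` (`σ_p` a cubic with `σ_p(p) = Δ_r'(p)`), and for an exponent
`z` satisfying the spin-`s` indicial relation `z² + sz = −Ξ²K(p)²/Δ_r'(p)² + isΞK(p)/Δ_r'(p)`
(`z = B(p)` or `z = −s − B(p)`), there are coefficients `P`, `Q`, continuous near `p`, with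
`Re P(p) = 2Re z + s + 1`, `σ_p P = 2zσ_p + (s+1)Δ_r'` and
`σ_p(r − p)Q = σ_p(z² − z) + z(s+1)Δ_r' + V_s·(r − p)`: the equation for the cofactor `f` of a branch
`R = (r − p)^z f` of the radial Teukolsky equation `Δ_r R'' + (s+1)Δ_r'R' + V_s R = 0` is
`(r − p)f'' + Pf' + Qf = 0`, and the cancellation of the `1/(r − p)` singularity of `Q` is the
indicial relation. (The `s = 0` case is `exists_branchCoeffs`.)
[cite: CasalsTeixeiradacosta2022, Theorem 3.10 (proof, Step 1)] -/
theorem exists_branchCoeffs_spin (M a Λ s : ℝ) (ω : ℂ) (m : ℝ) (lam : ℂ) {p : ℝ}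
    (hp : delta M a Λ p = 0) (hd : deltaDeriv M a Λ p ≠ 0) {z : ℂ}
    (hz : z ^ 2 + (s : ℂ) * z =
      -((xi a Λ : ℂ) ^ 2 * radialK a ω m p ^ 2 / (deltaDeriv M a Λ p : ℂ) ^ 2) +
        I * (s : ℂ) * (xi a Λ : ℂ) * radialK a ω m p / (deltaDeriv M a Λ p : ℂ)) :
    ∃ ε > 0, ∃ σ : ℝ → ℝ, ∃ P Q : ℝ → ℂ,
      (∀ r, delta M a Λ r = (r - p) * σ r) ∧ (∀ r ∈ Ioo (p - ε) (p + ε), σ r ≠ 0) ∧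
      ContinuousOn P (Ioo (p - ε) (p + ε)) ∧ ContinuousOn Q (Ioo (p - ε) (p + ε)) ∧
      (P p).re = 2 * z.re + (s + 1) ∧
      (∀ r ∈ Ioo (p - ε) (p + ε),
        (σ r : ℂ) * P r = 2 * z * σ r + (((s + 1) * deltaDeriv M a Λ r : ℝ) : ℂ)) ∧
      (∀ r ∈ Ioo (p - ε) (p + ε), r ≠ p →
        (σ r : ℂ) * ((r - p : ℝ) : ℂ) * Q r =
          (σ r : ℂ) * (z ^ 2 - z) + z * (((s + 1) * deltaDeriv M a Λ r : ℝ) : ℂ) +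
            radialPotential M a Λ s ω m lam r * ((r - p : ℝ) : ℂ)) := by
  -- the polynomial data of the factorisation `Δ = (r − p)σ`, `Δ' = σ + (r − p)σd`
  set d : ℝ := deltaDeriv M a Λ p with hd_def
  set c₂ : ℝ := 1 - Λ / 3 * a ^ 2 - 2 * Λ * p ^ 2 with hc₂
  set L : ℝ → ℝ := fun r => c₂ - 4 * Λ / 3 * p * (r - p) - Λ / 3 * (r - p) ^ 2 with hL
  set σ : ℝ → ℝ := fun r => d + (r - p) * L r with hσ
  set σd : ℝ → ℝ := fun r => c₂ - 8 * Λ / 3 * p * (r - p) - Λ * (r - p) ^ 2 with hσd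
  have hΔσ : ∀ r, delta M a Λ r = (r - p) * σ r := fun r => by
    rw [delta_taylor M a Λ p r, hp]
    simp only [hσ, hL, hc₂, hd_def]
    ring
  have hDσ : ∀ r, deltaDeriv M a Λ r = σ r + (r - p) * σd r := fun r => by
    simp only [hσ, hσd, hL, hc₂, hd_def, deltaDeriv]
    ring
  -- the frequency data
  set Kp : ℂ := radialK a ω m p with hKp
  set ρ : ℝ → ℂ := fun r => ω * ((r + p : ℝ) : ℂ) * (d : ℂ) - Kp * (L r : ℂ) with hρ
  have hKρ : ∀ r, radialK a ω m r * (d : ℂ) - Kp * (σ r : ℂ) = ((r - p : ℝ) : ℂ) * ρ r := fun r => by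
    simp only [hρ, hσ, hKp, radialK]
    push_cast
    ring
  -- the regular part of the spin-`s` coefficient
  set W : ℝ → ℂ := fun r => 4 * I * (s : ℂ) * (xi a Λ : ℂ) * ω * (r : ℂ) -
      ((2 * Λ / 3 * (s + 1) * (2 * s + 1) * r ^ 2 : ℝ) : ℂ) +
      ((2 * s * (1 - alpha a Λ) : ℝ) : ℂ) - lam with hW
  set P : ℝ → ℂ := fun r => 2 * z + (((s + 1) * deltaDeriv M a Λ r : ℝ) : ℂ) / (σ r : ℂ) with hP
  set Q : ℝ → ℂ := fun r =>
    (ρ r * ((xi a Λ : ℂ) ^ 2 * (radialK a ω m r * (d : ℂ) + (σ r : ℂ) * Kp) / ((σ r : ℂ) * (d : ℂ) ^ 2) -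
          I * (s : ℂ) * (xi a Λ : ℂ) / (d : ℂ)) +
        z * ((s + 1 : ℝ) : ℂ) * (σd r : ℂ) - I * (s : ℂ) * (xi a Λ : ℂ) * radialK a ω m r * (σd r : ℂ) / (σ r : ℂ) +
        W r) / (σ r : ℂ) with hQ
  -- a neighbourhood of `p` where `σ ≠ 0`
  have hσc : Continuous σ := by rw [hσ, hL]; fun_prop
  have hσp : σ p = d := by simp [hσ]
  have hev : ∀ᶠ r in 𝓝 p, σ r ≠ 0 := by
    have h := hσc.continuousAt (x := p)
    rw [ContinuousAt, hσp] at h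
    exact h.eventually_ne hd
  obtain ⟨ε, hε, hεσ⟩ := Metric.eventually_nhds_iff.1 hev
  have hσne : ∀ r ∈ Ioo (p - ε) (p + ε), σ r ≠ 0 := fun r hr =>
    hεσ (by rw [Real.dist_eq, abs_lt]; constructor <;> linarith [hr.1, hr.2])
  have hσne' : ∀ r ∈ Ioo (p - ε) (p + ε), (σ r : ℂ) ≠ 0 := fun r hr => by
    exact_mod_cast hσne r hr
  have hd' : (d : ℂ) ≠ 0 := by exact_mod_cast hd
  refine ⟨ε, hε, σ, P, Q, hΔσ, hσne, ?_, ?_, ?_, ?_, ?_⟩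
  · -- continuity of `P`
    have h1 : Continuous fun r : ℝ => (((s + 1) * deltaDeriv M a Λ r : ℝ) : ℂ) := by
      unfold deltaDeriv; fun_prop
    have h2 : Continuous fun r : ℝ => (σ r : ℂ) := continuous_ofReal.comp hσc
    rw [hP]
    exact continuousOn_const.add (h1.continuousOn.div h2.continuousOn hσne')
  · -- continuity of `Q`
    have h2 : Continuous fun r : ℝ => (σ r : ℂ) := continuous_ofReal.comp hσc
    have hρc : Continuous ρ := by rw [hρ, hL]; fun_prop
    have hKc : Continuous fun r : ℝ => radialK a ω m r := by unfold radialK; fun_prop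
    have hσdc : Continuous fun r : ℝ => (σd r : ℂ) := by rw [hσd]; fun_prop
    have hWc : Continuous W := by rw [hW]; fun_prop
    rw [hQ]
    refine ContinuousOn.div ?_ h2.continuousOn hσne'
    refine ((ContinuousOn.add ?_ ?_).sub ?_).add hWc.continuousOn
    · refine hρc.continuousOn.mul (ContinuousOn.sub ?_ continuousOn_const)
      exact (continuousOn_const.mul ((hKc.continuousOn.mul continuousOn_const).add
        (h2.continuousOn.mul continuousOn_const))).div
        (h2.continuousOn.mul continuousOn_const) fun r hr => mul_ne_zero (hσne' r hr) (pow_ne_zero 2 hd')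
    · exact (continuousOn_const.mul continuousOn_const).mul hσdc.continuousOn
    · exact ((((continuousOn_const.mul continuousOn_const).mul continuousOn_const).mul
        hKc.continuousOn).mul hσdc.continuousOn).div h2.continuousOn hσne'
  · -- `Re P(p) = 2 Re z + s + 1`
    have hσp' : (σ p : ℂ) = d := by rw [hσp]
    have hq : (((s + 1) * deltaDeriv M a Λ p : ℝ) : ℂ) / (d : ℂ) = ((s + 1 : ℝ) : ℂ) := by
      rw [← hd_def]
      push_cast
      field_simp
    simp only [hP, hσp', hq, add_re, mul_re, ofReal_re]
    norm_num
  · -- `σ P = 2zσ + (s+1)Δ'`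
    intro r hr
    simp only [hP]
    field_simp [hσne' r hr]
  · -- `σ (r − p) Q = σ(z² − z) + z(s+1)Δ' + V (r − p)`
    intro r hr hrp
    have hσr := hσne' r hr
    have ht : ((r - p : ℝ) : ℂ) ≠ 0 := by exact_mod_cast sub_ne_zero.2 hrp
    have hρ' : ρ r = (radialK a ω m r * (d : ℂ) - Kp * (σ r : ℂ)) / ((r - p : ℝ) : ℂ) := by
      rw [eq_div_iff ht, mul_comm]; exact (hKρ r).symm
    have hV : radialPotential M a Λ s ω m lam r =
        ((xi a Λ : ℂ) ^ 2 * radialK a ω m r ^ 2 -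
            I * (s : ℂ) * (xi a Λ : ℂ) * radialK a ω m r * (deltaDeriv M a Λ r : ℂ)) /
            (((r - p : ℝ) : ℂ) * (σ r : ℂ)) + W r := by
      rw [radialPotential_split, hΔσ r]
      simp only [hW]
      push_cast
      ring
    have hDr : (deltaDeriv M a Λ r : ℂ) = σ r + ((r - p : ℝ) : ℂ) * σd r := by
      rw [hDσ r]; push_cast; ring
    have hDr' : (((s + 1) * deltaDeriv M a Λ r : ℝ) : ℂ) =
        ((s + 1 : ℝ) : ℂ) * ((σ r : ℂ) + ((r - p : ℝ) : ℂ) * σd r) := by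
      rw [← hDr]; push_cast; ring
    have hz' : z ^ 2 = -((xi a Λ : ℂ) ^ 2 * Kp ^ 2 / (d : ℂ) ^ 2) +
        I * (s : ℂ) * (xi a Λ : ℂ) * Kp / (d : ℂ) - (s : ℂ) * z := by
      rw [hKp, hd_def]
      linear_combination hz
    have ht2 : (r : ℂ) - (p : ℂ) ≠ 0 := by
      have h := ht
      push_cast at h
      exact h
    simp only [hQ]
    rw [hV, hDr, hDr', hρ', hz']
    push_cast
    field_simp
    ring

/-! ### Unique continuation from a vanishing horizon amplitude, spin `s` -/

/-- **An ingoing spin-`s` solution whose event-horizon amplitude vanishes is identically zero**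
(`Im ω ≥ 0`, `s < 1`). On subextremal Kerr–de Sitter, let `R` solve the spin-`s` radial Teukolsky
equation on `(r₊, r_c)` with `R(r)(r − r₊)^{s + B(r₊)} = f(r)` near `r₊`, `f` smooth at `r₊`
(`IsIngoingAtEventHorizon`'s representation). If `f(r₊) = 0` then `R ≡ 0`: unique continuation at the
regular singular point `r₊` (branch exponent `z = −s − B(r₊)`,
`Re P(r₊) = 2Re z + s + 1 = 1 − s + 2Ξ(r₊²+a²)Im ω/Δ_r'(r₊) > 0`) followed by Grönwall uniqueness
along the exterior. [cite: CasalsTeixeiradacosta2022, Theorem 3.10 (proof, Step 1)] -/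
theorem radial_eq_zero_of_eventAmplitude_eq_zero {M a Λ s : ℝ} {ω : ℂ} {m : ℝ} {lam : ℂ}
    (hsub : IsSubextremal M a Λ) (hω : 0 ≤ ω.im) (hs : s < 1) {R : ℝ → ℂ}
    (hR : IsRadialTeukolskySolution M a Λ s ω m lam R) {ε : ℝ} (hε : 0 < ε) {f : ℝ → ℂ}
    (hf : ContDiffOn ℝ ((⊤ : ℕ∞) : WithTop ℕ∞) f (Ioo (rPlus M a Λ - ε) (rPlus M a Λ + ε)))
    (hRf : ∀ r ∈ Ioo (rPlus M a Λ) (rPlus M a Λ + ε),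
      R r * ((r - rPlus M a Λ : ℝ) : ℂ) ^ ((s : ℂ) + horizonB M a Λ ω m (rPlus M a Λ)) = f r)
    (hf0 : f (rPlus M a Λ) = 0) :
    ∀ r ∈ Ioo (rPlus M a Λ) (rCosmo M a Λ), R r = 0 := by
  have hd1 := deltaDeriv_rPlus_pos hsub
  have hsub' := hsub
  obtain ⟨hM, hΛ, h01, h12, hΔ1, hΔ2, -, hΔpos, -⟩ := hsub
  have hξ : 0 < xi a Λ := xi_pos hΛ.le a
  have hr₁ : 0 < rPlus M a Λ := lt_of_le_of_lt (rMinus_nonneg M a Λ) h01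
  set p := rPlus M a Λ with hp_def
  set z : ℂ := -(s : ℂ) - horizonB M a Λ ω m p with hz_def
  have hz2 := negSpinSub_horizonB_indicial M a Λ s ω m p
  rw [← hz_def] at hz2
  have hzre : -s ≤ z.re := by
    rw [hz_def, sub_re, neg_re, ofReal_re, re_horizonB]
    have hsq : 0 < p ^ 2 + a ^ 2 := add_pos_of_pos_of_nonneg (pow_pos hr₁ 2) (sq_nonneg a)
    have h : 0 ≤ xi a Λ * (p ^ 2 + a ^ 2) * ω.im / deltaDeriv M a Λ p :=
      div_nonneg (mul_nonneg (mul_pos hξ hsq).le hω) hd1.le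
    rw [neg_div] 
    linarith
  obtain ⟨ε₁, hε₁, σ, P, Q, hΔσ, hσne, hPc, hQc, hPp, hPJ, hQJ⟩ :=
    exists_branchCoeffs_spin M a Λ s ω m lam hΔ1 hd1.ne' hz2
  obtain ⟨R', R'', hode⟩ := id hR
  -- the common neighbourhood
  set ε' : ℝ := min ε (min ε₁ (rCosmo M a Λ - p)) with hε'
  have hε'pos : 0 < ε' := lt_min hε (lt_min hε₁ (by linarith))
  have hε'ε : ε' ≤ ε := min_le_left _ _
  have hε'1 : ε' ≤ ε₁ := (min_le_right _ _).trans (min_le_left _ _)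
  have hε'c : ε' ≤ rCosmo M a Λ - p := (min_le_right _ _).trans (min_le_right _ _)
  have hU1 : Ioo (p - ε') (p + ε') ⊆ Ioo (p - ε₁) (p + ε₁) := fun r hr =>
    ⟨by linarith [hr.1], by linarith [hr.2]⟩
  have hJ : ∀ r ∈ Ioo p (p + ε'), r ∈ Ioo (rPlus M a Λ) (rCosmo M a Λ) := fun r hr =>
    ⟨hr.1, by linarith [hr.2]⟩
  obtain ⟨T, hT, hzero⟩ := eq_zero_near_of_cpowBranch_zero (x₀ := p) hε'pos (z := z)
    (ℓ := σ) (D := fun r => (s + 1) * deltaDeriv M a Λ r)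
    (V := fun r => radialPotential M a Λ s ω m lam r) (f := f)
    (hf.mono fun r hr => ⟨by linarith [hr.1], by linarith [hr.2]⟩) hf0
    (R := R) (R' := R') (R'' := R'')
    (fun r hr => by
      obtain ⟨h1, h2, heq⟩ := hode r (hJ r hr)
      refine ⟨h1, h2, ?_⟩
      have hc : (delta M a Λ r : ℂ) = (σ r : ℂ) * ((r - p : ℝ) : ℂ) := by
        rw [hΔσ r]; push_cast; ring
      rw [hc] at heq
      push_cast at heq ⊢
      linear_combination heq)
    (fun r hr => by
      have hx0 : (0 : ℝ) < r - p := by linarith [hr.1]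
      have hne : ((r - p : ℝ) : ℂ) ≠ 0 := by exact_mod_cast hx0.ne'
      have h := hRf r ⟨hr.1, lt_of_lt_of_le hr.2 (by linarith)⟩
      have hpow : ((r - p : ℝ) : ℂ) ^ ((s : ℂ) + horizonB M a Λ ω m p) ≠ 0 := by
        rw [Ne, cpow_eq_zero_iff, not_and_or]; exact Or.inl hne
      have hzneg : z = -((s : ℂ) + horizonB M a Λ ω m p) := by rw [hz_def]; ring
      rw [hzneg, cpow_neg, ← h, mul_comm (R r) _, ← mul_assoc, inv_mul_cancel₀ hpow, one_mul])
    (fun r hr => hσne r (hU1 ⟨by linarith [hr.1], hr.2⟩))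
    (P := P) (Q := Q) (hPc.mono hU1) (hQc.mono hU1) (by rw [hPp]; linarith)
    (fun r hr => by
      have h := hPJ r (hU1 ⟨by linarith [hr.1], hr.2⟩)
      push_cast at h ⊢
      linear_combination h)
    (fun r hr => by
      have h := hQJ r (hU1 ⟨by linarith [hr.1], hr.2⟩) (ne_of_gt hr.1)
      push_cast at h ⊢
      linear_combination h)
  -- a point of the exterior with a neighbourhood where `R = 0`
  set r₁ : ℝ := p + min T ε' / 2 with hr₁_def
  have hmin : 0 < min T ε' := lt_min hT hε'pos
  have hr₁J : r₁ ∈ Ioo p (p + min T ε') := ⟨by linarith, by linarith⟩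
  have hr₁D : r₁ ∈ Ioo (rPlus M a Λ) (rCosmo M a Λ) :=
    hJ r₁ ⟨hr₁J.1, lt_of_lt_of_le hr₁J.2 (by linarith [min_le_right T ε'])⟩
  have hev : ∀ᶠ r in 𝓝 r₁, R r = 0 := by
    filter_upwards [isOpen_Ioo.mem_nhds hr₁J] with r hr
    exact hzero r ⟨hr.1, lt_of_lt_of_le hr.2 (by linarith [min_le_left T ε'])⟩
  have hM1 : IsMasterRadialSolution M a Λ s 1 ω m (lambdaBar a Λ s ω m lam) R :=
    (isMasterRadialSolution_one_iff M a Λ s ω m lam R).2 hR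
  exact masterRadial_eq_zero_of_eventuallyEq_zero (fun r hr => (hΔpos r hr).ne') hM1 hr₁D hev

/-- **An outgoing spin-`s` solution whose cosmological-horizon amplitude vanishes is identically
zero** (`Im ω ≥ 0`, `−1 < s`): `R(r)(r_c − r)^{−B(r_c)} = g(r)` near `r_c` with `g` smooth,
`g(r_c) = 0` forces `R ≡ 0` on `(r₊, r_c)` (branch exponent `z = B(r_c)`,
`Re P(r_c) = 1 + s − 2Ξ(r_c²+a²)Im ω/Δ_r'(r_c) > 0` as `Δ_r'(r_c) < 0`).
[cite: CasalsTeixeiradacosta2022, Theorem 3.10 (proof, Step 1)] -/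
theorem radial_eq_zero_of_cosmoAmplitude_eq_zero {M a Λ s : ℝ} {ω : ℂ} {m : ℝ} {lam : ℂ}
    (hsub : IsSubextremal M a Λ) (hω : 0 ≤ ω.im) (hs : -1 < s) {R : ℝ → ℂ}
    (hR : IsRadialTeukolskySolution M a Λ s ω m lam R) {ε : ℝ} (hε : 0 < ε) {g : ℝ → ℂ}
    (hg : ContDiffOn ℝ ((⊤ : ℕ∞) : WithTop ℕ∞) g (Ioo (rCosmo M a Λ - ε) (rCosmo M a Λ + ε)))
    (hRg : ∀ r ∈ Ioo (rCosmo M a Λ - ε) (rCosmo M a Λ),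
      R r * ((rCosmo M a Λ - r : ℝ) : ℂ) ^ (-horizonB M a Λ ω m (rCosmo M a Λ)) = g r)
    (hg0 : g (rCosmo M a Λ) = 0) :
    ∀ r ∈ Ioo (rPlus M a Λ) (rCosmo M a Λ), R r = 0 := by
  have hd2 := deltaDeriv_rCosmo_neg hsub
  have hsub' := hsub
  obtain ⟨hM, hΛ, h01, h12, hΔ1, hΔ2, -, hΔpos, -⟩ := hsub
  have hξ : 0 < xi a Λ := xi_pos hΛ.le a
  have hr₁ : 0 < rPlus M a Λ := lt_of_le_of_lt (rMinus_nonneg M a Λ) h01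
  have hr₂ : 0 < rCosmo M a Λ := hr₁.trans h12
  set p := rCosmo M a Λ with hp_def
  set z : ℂ := horizonB M a Λ ω m p with hz_def
  have hz2 := horizonB_indicial M a Λ s ω m p
  rw [← hz_def] at hz2
  have hzre : 0 ≤ z.re := by
    rw [hz_def, re_horizonB]
    have hsq : 0 < p ^ 2 + a ^ 2 := add_pos_of_pos_of_nonneg (pow_pos hr₂ 2) (sq_nonneg a)
    have hnum : 0 ≤ xi a Λ * (p ^ 2 + a ^ 2) * ω.im := mul_nonneg (mul_pos hξ hsq).le hω
    exact div_nonneg_of_nonpos (by linarith) hd2.le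
  obtain ⟨ε₁, hε₁, σ, P, Q, hΔσ, hσne, hPc, hQc, hPp, hPJ, hQJ⟩ :=
    exists_branchCoeffs_spin M a Λ s ω m lam hΔ2 hd2.ne hz2
  obtain ⟨R', R'', hode⟩ := id hR
  set ε' : ℝ := min ε (min ε₁ (p - rPlus M a Λ)) with hε'
  have hε'pos : 0 < ε' := lt_min hε (lt_min hε₁ (by linarith))
  have hε'ε : ε' ≤ ε := min_le_left _ _
  have hε'1 : ε' ≤ ε₁ := (min_le_right _ _).trans (min_le_left _ _)
  have hε'c : ε' ≤ p - rPlus M a Λ := (min_le_right _ _).trans (min_le_right _ _)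
  have hU1 : Ioo (p - ε') (p + ε') ⊆ Ioo (p - ε₁) (p + ε₁) := fun r hr =>
    ⟨by linarith [hr.1], by linarith [hr.2]⟩
  have hJ : ∀ r ∈ Ioo (p - ε') p, r ∈ Ioo (rPlus M a Λ) (rCosmo M a Λ) := fun r hr =>
    ⟨by linarith [hr.1], hr.2⟩
  obtain ⟨T, hT, hzero⟩ := eq_zero_near_of_cpowBranch_zero_left (x₀ := p) hε'pos (z := z)
    (ℓ := σ) (D := fun r => (s + 1) * deltaDeriv M a Λ r)
    (V := fun r => radialPotential M a Λ s ω m lam r) (f := g)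
    (hg.mono fun r hr => ⟨by linarith [hr.1], by linarith [hr.2]⟩) hg0
    (R := R) (R' := R') (R'' := R'')
    (fun r hr => by
      obtain ⟨h1, h2, heq⟩ := hode r (hJ r hr)
      refine ⟨h1, h2, ?_⟩
      have hc : (delta M a Λ r : ℂ) = (σ r : ℂ) * ((r - p : ℝ) : ℂ) := by
        rw [hΔσ r]; push_cast; ring
      rw [hc] at heq
      push_cast at heq ⊢
      linear_combination heq)
    (fun r hr => by
      have hx0 : (0 : ℝ) < p - r := by linarith [hr.2]
      have hne : ((p - r : ℝ) : ℂ) ≠ 0 := by exact_mod_cast hx0.ne'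
      have h := hRg r ⟨lt_of_le_of_lt (by linarith) hr.1, hr.2⟩
      have hpow : ((p - r : ℝ) : ℂ) ^ horizonB M a Λ ω m p ≠ 0 := by
        rw [Ne, cpow_eq_zero_iff, not_and_or]; exact Or.inl hne
      rw [cpow_neg] at h
      rw [hz_def, ← h, mul_comm (R r) _, ← mul_assoc, mul_inv_cancel₀ hpow, one_mul])
    (fun r hr => hσne r (hU1 ⟨hr.1, by linarith [hr.2]⟩))
    (P := P) (Q := Q) (hPc.mono hU1) (hQc.mono hU1) (by rw [hPp]; linarith)
    (fun r hr => by
      have h := hPJ r (hU1 ⟨hr.1, by linarith [hr.2]⟩)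
      push_cast at h ⊢
      linear_combination h)
    (fun r hr => by
      have h := hQJ r (hU1 ⟨hr.1, by linarith [hr.2]⟩) (ne_of_lt hr.2)
      push_cast at h ⊢
      linear_combination h)
  set r₁ : ℝ := p - min T ε' / 2 with hr₁_def
  have hmin : 0 < min T ε' := lt_min hT hε'pos
  have hr₁J : r₁ ∈ Ioo (p - min T ε') p := ⟨by linarith, by linarith⟩
  have hr₁D : r₁ ∈ Ioo (rPlus M a Λ) (rCosmo M a Λ) :=
    hJ r₁ ⟨lt_of_le_of_lt (by linarith [min_le_right T ε']) hr₁J.1, hr₁J.2⟩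
  have hev : ∀ᶠ r in 𝓝 r₁, R r = 0 := by
    filter_upwards [isOpen_Ioo.mem_nhds hr₁J] with r hr
    exact hzero r ⟨lt_of_le_of_lt (by linarith [min_le_left T ε']) hr.1, hr.2⟩
  have hM1 : IsMasterRadialSolution M a Λ s 1 ω m (lambdaBar a Λ s ω m lam) R :=
    (isMasterRadialSolution_one_iff M a Λ s ω m lam R).2 hR
  exact masterRadial_eq_zero_of_eventuallyEq_zero (fun r hr => (hΔpos r hr).ne') hM1 hr₁D hev

end Literature.Geometry.Lorentzian.KerrDeSitter

end
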